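import Mathlib

/-!
# C-025 at q = 3: the two tight planar identities of the lifted rule R₃⁺ (night-3)

The rank level-set inequality (RLS)(p,3) is proved per rank-3 flat `G` by distributing the unit mass of every
witness `S` (`3 < r(S) < p`) over the rank-3 flats of `M|S` with the basis-count weights `ρ₃` (the rule `R₃`
of Theorem 25, = the lifted rule `R₃⁺` whenever every trace has ≤ 5 points and no 4-point line).  In the
reduced generic world (`G ⊔ K`, `K = p − t` generic points) the per-flat inequality at type `t` reads
`Σ_{B' ⊆ G, r(B') = 3} Σ_{x=1}^{p−4} C(p−t, x) · ρ₃(B') / ρ₃(B' ∪ X) ≥ Φ(p,3) · #{B' : r(G ∖ B') ≥ t}`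
with `ρ₃(B' ∪ X) = C(b + x, 3)` for a generic `b`-point `B'`, and
`Φ(p,3) = Σ_{x=1}^{p−4} C(p,x)/C(x+3,3)` (the witness form of `phiK p 3`, `phiW_eq_phiK_form` below).

The two planes on which `R₃` / `R₃⁺` is asymptotically tight are `U_{3,4}` at `t = 1` and `U_{3,5}` at `t = 2`;
both inequalities are exact telescoping identities, valid for EVERY `p ≥ 4` (written `p = n + 4`):

* `U_{3,4}`, `t = 1` (outside points `p − 1 = n + 3`; four triples with share `1/C(x+3,3)`, the plane with
  share `4/C(x+4,3)`):  `supply − 4·Φ = (3p − 12)/p`  (`u34_t1_identity`, `u34_t1_ineq`);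
* `U_{3,5}`, `t = 2` (outside points `p − 2 = n + 2`; ten triples, five 4-sets with share `4/C(x+4,3)`, the plane
  with share `10/C(x+5,3)`):  `supply − 10·Φ = 20·(C(p−2,2)/C(p,3) − 1/4) + 10·(C(p−2,2)/C(p+1,3) + C(p−2,3)/C(p,3) − 1/10)
  = (4n³ + 78n² + 218n)/((n+3)(n+4)(n+5)) ≥ 0` (`u35_t2_identity`, `u35_t2_ineq`), tending to `4`.

No `decide`, no `norm_num` over tables: the proofs are Pascal's rule plus index shifts.
-/

namespace PercRepro.NightThree

open Finset

/-- The witness form of `Φ(p,3)` with `p = n + 4`: `Σ_{x=1}^{p−4} C(p,x)/C(x+3,3)`, indexed by `i = x − 1 < n`. -/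
def phiW (n : ℕ) : ℚ := ∑ i ∈ range n, ((n + 4).choose (i + 1) : ℚ) / ((i + 4).choose 3 : ℚ)

/-- Termwise `C(p+3, x+3)/C(p+3, 3) = C(p,x)/C(x+3,3)`: `C(p+3, x+3) · C(x+3, 3) = C(p+3, 3) · C(p, x)`. -/
theorem choose_mul_choose_three (p x : ℕ) :
    ((p + 3).choose (x + 3) : ℚ) * ((x + 3).choose 3 : ℚ) = ((p + 3).choose 3 : ℚ) * (p.choose x : ℚ) := by
  have h := Nat.choose_mul (n := p + 3) (k := x + 3) (s := 3) (by omega)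
  rw [Nat.add_sub_cancel, Nat.add_sub_cancel] at h
  exact_mod_cast h

/-- `Φ(p,3)` as `phiK p 3` unfolds (`Σ_{u ∈ Ioo 3 p} C(p+3,u) / C(p+3,p)`) equals the witness form `phiW (p − 4)`. -/
theorem phiW_eq_phiK_form (n : ℕ) :
    (∑ u ∈ Ioo 3 (n + 4), ((n + 4 + 3).choose u : ℚ)) / ((n + 4 + 3).choose (n + 4) : ℚ) = phiW n := by
  have hpos : (((n + 4 + 3).choose 3 : ℕ) : ℚ) ≠ 0 := by
    exact_mod_cast (Nat.choose_pos (by omega)).ne'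
  have hsym : (n + 4 + 3).choose (n + 4) = (n + 4 + 3).choose 3 :=
    Nat.choose_symm_of_eq_add (by omega)
  rw [hsym, div_eq_iff hpos]
  unfold phiW
  have hI : Ioo 3 (n + 4) = Ico 4 (n + 4) := by
    ext u; simp only [mem_Ioo, mem_Ico]; omega
  rw [hI, sum_Ico_eq_sum_range, show n + 4 - 4 = n by omega, sum_mul]
  apply sum_congr rfl
  intro i _
  have hx : (((i + 4).choose 3 : ℕ) : ℚ) ≠ 0 := by exact_mod_cast (Nat.choose_pos (by omega)).ne'
  rw [div_mul_eq_mul_div, eq_div_iff hx]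
  have := choose_mul_choose_three (n + 4) (i + 1)
  rw [show i + 1 + 3 = i + 4 by omega, show 4 + i = i + 4 by omega] at *
  linear_combination this

/-- Supply of the four triples of `U_{3,4}` at `t = 1`, `p = n + 4`: `Σ_{x=1}^{p−4} C(p−1,x)/C(x+3,3)`. -/
def s1 (n : ℕ) : ℚ := ∑ i ∈ range n, ((n + 3).choose (i + 1) : ℚ) / ((i + 4).choose 3 : ℚ)

/-- Supply of the plane `U_{3,4}` itself at `t = 1` divided by its weight 4: `Σ_{x=1}^{p−4} C(p−1,x)/C(x+4,3)`. -/
def s2 (n : ℕ) : ℚ := ∑ i ∈ range n, ((n + 3).choose (i + 1) : ℚ) / ((i + 5).choose 3 : ℚ)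

/-- `C(n+3, 3) / C(n+4, 3) = (n+1)/(n+4)`. -/
theorem choose_three_ratio (n : ℕ) :
    ((n + 3).choose 3 : ℚ) / ((n + 4).choose 3 : ℚ) = ((n : ℚ) + 1) / ((n : ℚ) + 4) := by
  have h := Nat.choose_mul_succ_eq (n + 3) 3
  rw [show n + 3 + 1 = n + 4 by omega, show n + 4 - 3 = n + 1 by omega] at h
  have h' : ((n + 3).choose 3 : ℚ) * ((n : ℚ) + 4) = ((n + 4).choose 3 : ℚ) * ((n : ℚ) + 1) := by
    exact_mod_cast h
  have h1 : (((n + 4).choose 3 : ℕ) : ℚ) ≠ 0 := by exact_mod_cast (Nat.choose_pos (by omega)).ne'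
  have h2 : ((n : ℚ) + 4) ≠ 0 := by positivity
  rw [div_eq_div_iff h1 h2]
  linear_combination h'

/-- **The `U_{3,4}`, `t = 1` identity** (`p = n + 4`): `s1 + s2 − phiW = (p − 3)/p − 1/4`. -/
theorem u34_t1_identity (n : ℕ) : s1 n + s2 n - phiW n = ((n : ℚ) + 1) / ((n : ℚ) + 4) - 1 / 4 := by
  -- Pascal: phiW = s1 + R with R = Σ_{i<n} C(n+3, i)/C(i+4,3)
  have hpascal : phiW n = s1 n + ∑ i ∈ range n, ((n + 3).choose i : ℚ) / ((i + 4).choose 3 : ℚ) := by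
    unfold phiW s1
    rw [← sum_add_distrib]
    apply sum_congr rfl
    intro i _
    rw [← add_div]
    congr 1
    rw [show n + 4 = n + 3 + 1 by omega, Nat.choose_succ_succ']
    push_cast; ring
  -- the shift: Σ_{i<n} C(n+3,i)/C(i+4,3) + C(n+3,n)/C(n+4,3) = s2 + C(n+3,0)/C(4,3)
  have hshift : (∑ i ∈ range n, ((n + 3).choose i : ℚ) / ((i + 4).choose 3 : ℚ)) +
      ((n + 3).choose n : ℚ) / ((n + 4).choose 3 : ℚ) = s2 n + ((n + 3).choose 0 : ℚ) / ((4).choose 3 : ℚ) := by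
    set f : ℕ → ℚ := fun i => ((n + 3).choose i : ℚ) / ((i + 4).choose 3 : ℚ) with hf
    have e1 := sum_range_succ f n
    have e2 := sum_range_succ' f n
    have e3 : s2 n = ∑ i ∈ range n, f (i + 1) := by
      unfold s2
      apply sum_congr rfl
      intro i _
      simp only [hf]
    rw [e3]
    have e4 : f n = ((n + 3).choose n : ℚ) / ((n + 4).choose 3 : ℚ) := by simp only [hf]
    have e5 : f 0 = ((n + 3).choose 0 : ℚ) / ((4).choose 3 : ℚ) := by simp only [hf]
    rw [← e4, ← e5, ← e1, e2]
  have hsym : ((n + 3).choose n : ℚ) = ((n + 3).choose 3 : ℚ) := by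
    rw [Nat.choose_symm_of_eq_add (by omega : n + 3 = n + 3)]
  rw [hpascal]
  have hc0 : ((n + 3).choose 0 : ℚ) / ((4).choose 3 : ℚ) = 1 / 4 := by simp
  rw [hc0, hsym, choose_three_ratio] at hshift
  linear_combination -hshift

/-- **`U_{3,4}` at `t = 1` holds for every `p ≥ 4`**: `4·(s1 + s2) ≥ 4·Φ(p,3)`, with margin `(3p − 12)/p`. -/
theorem u34_t1_ineq (n : ℕ) : 4 * phiW n ≤ 4 * s1 n + 4 * s2 n := by
  have h := u34_t1_identity n
  have h4 : (0 : ℚ) < (n : ℚ) + 4 := by positivity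
  have : ((n : ℚ) + 1) / ((n : ℚ) + 4) - 1 / 4 ≥ 0 := by
    rw [ge_iff_le, sub_nonneg, div_le_div_iff₀ (by norm_num) h4]
    have : (0 : ℚ) ≤ (n : ℚ) := by positivity
    nlinarith
  linarith

/-! ## The `U_{3,5}`, `t = 2` identity -/

/-- The shifted witness sums `T n m k := Σ_{i<n} C(m, i+1) / C(i+k+4, 3)`; `phiW n = T n (n+4) 0`, and the three
`U_{3,5}` supplies at `t = 2` (outside points `p − 2 = n + 2`) are `T n (n+2) 0`, `T n (n+2) 1`, `T n (n+2) 2`. -/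
def T (n m k : ℕ) : ℚ := ∑ i ∈ range n, (m.choose (i + 1) : ℚ) / ((i + k + 4).choose 3 : ℚ)

/-- Pascal + shift: `T n (m+1) k = T n m k + T n m (k+1) + 1/C(k+4,3) − C(m,n)/C(n+k+4,3)`. -/
theorem T_succ (n m k : ℕ) :
    T n (m + 1) k = T n m k + T n m (k + 1) + 1 / ((k + 4).choose 3 : ℚ) - (m.choose n : ℚ) / ((n + k + 4).choose 3 : ℚ) := by
  set f : ℕ → ℚ := fun i => (m.choose i : ℚ) / ((i + k + 4).choose 3 : ℚ) with hf
  have hpascal : T n (m + 1) k = T n m k + ∑ i ∈ range n, f i := by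
    unfold T
    rw [← sum_add_distrib]
    apply sum_congr rfl
    intro i _
    simp only [hf]
    rw [← add_div, Nat.choose_succ_succ']
    push_cast; ring
  have e1 := sum_range_succ f n
  have e2 := sum_range_succ' f n
  have e3 : T n m (k + 1) = ∑ i ∈ range n, f (i + 1) := by
    unfold T
    apply sum_congr rfl
    intro i _
    simp only [hf]
    rw [show i + 1 + k + 4 = i + (k + 1) + 4 by omega]
  have e4 : f n = (m.choose n : ℚ) / ((n + k + 4).choose 3 : ℚ) := by simp only [hf]
  have e5 : f 0 = 1 / ((k + 4).choose 3 : ℚ) := by simp only [hf]; simp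
  rw [hpascal, e3]
  have e6 : ∑ i ∈ range n, f i = ∑ i ∈ range n, f (i + 1) + f 0 - f n := by linarith
  rw [e6, e4, e5]; ring

/-- `phiW n = T n (n+4) 0`. -/
theorem phiW_eq_T (n : ℕ) : phiW n = T n (n + 4) 0 := by
  unfold phiW T
  apply sum_congr rfl
  intro i _
  rw [show i + 0 + 4 = i + 4 by omega]

/-- `C(n+2, 2) / C(n+4, 3) = 3(n+1)/((n+3)(n+4))`. -/
theorem choose_ratio_a (n : ℕ) :
    ((n + 2).choose 2 : ℚ) / ((n + 4).choose 3 : ℚ) = 3 * ((n : ℚ) + 1) / (((n : ℚ) + 3) * ((n : ℚ) + 4)) := by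
  have h1 := Nat.add_one_mul_choose_eq (n + 2) 2
  have h2 := Nat.choose_mul_succ_eq (n + 3) 3
  rw [show n + 2 + 1 = n + 3 by omega, show (2 : ℕ) + 1 = 3 by rfl] at h1
  rw [show n + 3 + 1 = n + 4 by omega, show n + 4 - 3 = n + 1 by omega] at h2
  have h1' : ((n : ℚ) + 3) * ((n + 2).choose 2 : ℚ) = ((n + 3).choose 3 : ℚ) * 3 := by exact_mod_cast h1
  have h2' : ((n + 3).choose 3 : ℚ) * ((n : ℚ) + 4) = ((n + 4).choose 3 : ℚ) * ((n : ℚ) + 1) := by exact_mod_cast h2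
  have hd : (((n + 4).choose 3 : ℕ) : ℚ) ≠ 0 := by exact_mod_cast (Nat.choose_pos (by omega)).ne'
  have h3 : ((n : ℚ) + 3) ≠ 0 := by positivity
  have h4 : ((n : ℚ) + 4) ≠ 0 := by positivity
  rw [div_eq_div_iff hd (mul_ne_zero h3 h4)]
  linear_combination ((n : ℚ) + 4) * h1' + 3 * h2'

/-- `C(n+2, 2) / C(n+5, 3) = 3(n+1)(n+2)/((n+3)(n+4)(n+5))`. -/
theorem choose_ratio_b (n : ℕ) :
    ((n + 2).choose 2 : ℚ) / ((n + 5).choose 3 : ℚ) =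
      3 * ((n : ℚ) + 1) * ((n : ℚ) + 2) / (((n : ℚ) + 3) * ((n : ℚ) + 4) * ((n : ℚ) + 5)) := by
  have ha := choose_ratio_a n
  have h5 := Nat.choose_mul_succ_eq (n + 4) 3
  rw [show n + 4 + 1 = n + 5 by omega, show n + 5 - 3 = n + 2 by omega] at h5
  have h5' : ((n + 4).choose 3 : ℚ) * ((n : ℚ) + 5) = ((n + 5).choose 3 : ℚ) * ((n : ℚ) + 2) := by exact_mod_cast h5
  have hd4 : (((n + 4).choose 3 : ℕ) : ℚ) ≠ 0 := by exact_mod_cast (Nat.choose_pos (by omega)).ne'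
  have hd5 : (((n + 5).choose 3 : ℕ) : ℚ) ≠ 0 := by exact_mod_cast (Nat.choose_pos (by omega)).ne'
  have h3 : ((n : ℚ) + 3) ≠ 0 := by positivity
  have h4 : ((n : ℚ) + 4) ≠ 0 := by positivity
  have h6 : ((n : ℚ) + 5) ≠ 0 := by positivity
  rw [div_eq_div_iff hd4 (mul_ne_zero h3 h4)] at ha
  rw [div_eq_div_iff hd5 (mul_ne_zero (mul_ne_zero h3 h4) h6)]
  linear_combination ((n : ℚ) + 5) * ha + 3 * ((n : ℚ) + 1) * h5'

/-- **The `U_{3,5}`, `t = 2` identity** (`p = n + 4`, outside points `n + 2`):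
`10·T(n+2,0) + 20·T(n+2,1) + 10·T(n+2,2) − 10·Φ = 20·(C(n+2,2)/C(n+4,3) − 1/4) + 10·(C(n+2,2)/C(n+5,3) + C(n+2,3)/C(n+4,3) − 1/10)`. -/
theorem u35_t2_identity (n : ℕ) :
    10 * T n (n + 2) 0 + 20 * T n (n + 2) 1 + 10 * T n (n + 2) 2 - 10 * phiW n =
      20 * (((n + 2).choose 2 : ℚ) / ((n + 4).choose 3 : ℚ) - 1 / 4) +
      10 * (((n + 2).choose 2 : ℚ) / ((n + 5).choose 3 : ℚ) + ((n + 2).choose 3 : ℚ) / ((n + 4).choose 3 : ℚ) - 1 / 10) := by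
  have s1 := T_succ n (n + 3) 0
  have s2 := T_succ n (n + 2) 0
  have s3 := T_succ n (n + 2) 1
  rw [show n + 3 + 1 = n + 4 by omega] at s1
  rw [show n + 2 + 1 = n + 3 by omega] at s2 s3
  rw [phiW_eq_T]
  have c1 : ((n + 3).choose n : ℚ) = ((n + 2).choose 3 : ℚ) + ((n + 2).choose 2 : ℚ) := by
    rw [Nat.choose_symm_of_eq_add (by omega : n + 3 = n + 3), show n + 3 = n + 2 + 1 by omega,
      show (3 : ℕ) = 2 + 1 by rfl, Nat.choose_succ_succ']
    push_cast; ring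
  have c2 : ((n + 2).choose n : ℚ) = ((n + 2).choose 2 : ℚ) := by
    rw [Nat.choose_symm_of_eq_add (by omega : n + 2 = n + 2)]
  have d0 : (((0 : ℕ) + 4).choose 3 : ℚ) = 4 := by norm_num
  have d1 : (((1 : ℕ) + 4).choose 3 : ℚ) = 10 := by norm_num [Nat.choose]
  have e0 : ((n + 0 + 4).choose 3 : ℚ) = ((n + 4).choose 3 : ℚ) := by rw [show n + 0 + 4 = n + 4 by omega]
  have e1 : ((n + 1 + 4).choose 3 : ℚ) = ((n + 5).choose 3 : ℚ) := by rw [show n + 1 + 4 = n + 5 by omega]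
  rw [d0, e0, c1, show (0 : ℕ) + 1 = 1 from rfl] at s1
  rw [d0, e0, c2, show (0 : ℕ) + 1 = 1 from rfl] at s2
  rw [d1, e1, c2, show (1 : ℕ) + 1 = 2 from rfl] at s3
  linear_combination (-10) * s1 - 10 * s2 - 10 * s3

/-- **`U_{3,5}` at `t = 2` holds for every `p ≥ 4`**, with margin
`20·(C(p−2,2)/C(p,3) − 1/4) + 10·(C(p−2,2)/C(p+1,3) + C(p−2,3)/C(p,3) − 1/10) = (4n³ + 78n² + 218n)/((n+3)(n+4)(n+5)) ≥ 0`. -/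
theorem u35_t2_ineq (n : ℕ) :
    10 * phiW n ≤ 10 * T n (n + 2) 0 + 20 * T n (n + 2) 1 + 10 * T n (n + 2) 2 := by
  have h := u35_t2_identity n
  have ha := choose_ratio_a n
  have hb := choose_ratio_b n
  have hc : ((n + 2).choose 3 : ℚ) / ((n + 4).choose 3 : ℚ) =
      ((n : ℚ) + 1) / ((n : ℚ) + 4) - 3 * ((n : ℚ) + 1) / (((n : ℚ) + 3) * ((n : ℚ) + 4)) := by
    have c1 : ((n + 3).choose 3 : ℚ) = ((n + 2).choose 3 : ℚ) + ((n + 2).choose 2 : ℚ) := by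
      rw [show n + 3 = n + 2 + 1 by omega, show (3 : ℕ) = 2 + 1 by rfl, Nat.choose_succ_succ']
      push_cast; ring
    have hr := choose_three_ratio n
    rw [c1, add_div, ha] at hr
    linear_combination hr
  rw [ha, hb, hc] at h
  have h3 : (0 : ℚ) < (n : ℚ) + 3 := by positivity
  have h4 : (0 : ℚ) < (n : ℚ) + 4 := by positivity
  have h5 : (0 : ℚ) < (n : ℚ) + 5 := by positivity
  have hn : (0 : ℚ) ≤ (n : ℚ) := by positivity
  have key : 0 ≤ 20 * (3 * ((n : ℚ) + 1) / (((n : ℚ) + 3) * ((n : ℚ) + 4)) - 1 / 4) +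
      10 * (3 * ((n : ℚ) + 1) * ((n : ℚ) + 2) / (((n : ℚ) + 3) * ((n : ℚ) + 4) * ((n : ℚ) + 5)) +
        (((n : ℚ) + 1) / ((n : ℚ) + 4) - 3 * ((n : ℚ) + 1) / (((n : ℚ) + 3) * ((n : ℚ) + 4))) - 1 / 10) := by
    have expand : 20 * (3 * ((n : ℚ) + 1) / (((n : ℚ) + 3) * ((n : ℚ) + 4)) - 1 / 4) +
        10 * (3 * ((n : ℚ) + 1) * ((n : ℚ) + 2) / (((n : ℚ) + 3) * ((n : ℚ) + 4) * ((n : ℚ) + 5)) +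
          (((n : ℚ) + 1) / ((n : ℚ) + 4) - 3 * ((n : ℚ) + 1) / (((n : ℚ) + 3) * ((n : ℚ) + 4))) - 1 / 10) =
        (4 * (n : ℚ) ^ 3 + 78 * (n : ℚ) ^ 2 + 218 * (n : ℚ)) / (((n : ℚ) + 3) * ((n : ℚ) + 4) * ((n : ℚ) + 5)) := by
      field_simp
      ring
    rw [expand]
    positivity
  linarith

end PercRepro.NightThree
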